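import Summits.Ventures.PackingBounds.Energy.NewtonCertificate
import Mathlib.Analysis.SpecialFunctions.Trigonometric.Chebyshev.Basic
import Mathlib.Analysis.SpecialFunctions.Trigonometric.Inverse

/-!
# The linear programming bound for energy on the circle `S¹` (Chebyshev form)

Framing: lottery ticket; floor = certified bounds/negative ranges. Venture `PackingBounds` (cell
`pub-packcert`, seat `pub-packcert-energy`), energy-minimisation family — the `n = 2` case, which the
tree's Gegenbauer normalisation (`μ = n/2 - 1 > 0`) excludes.

On `S¹` the zonal positive definite kernels are the Chebyshev polynomials of the first kind:
`T_k(⟨x,y⟩) = cos k(θ_x - θ_y)` and `Σ_{x,y} cos k(θ_x - θ_y) = (Σ_x cos kθ_x)² + (Σ_x sin kθ_x)² ≥ 0`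
(`CircleLP.sum_sum_chebyshev_nonneg`). Hence (Yudin / Cohn–Kumar Prop. 4.1 with `C_k` replaced by
`T_k`): if `h = Σ_{k ≤ d} α_k T_k`, `α_k ≥ 0`, `h ≤ a` on `[-1,1)`, every `N`-point `C ⊂ S¹` has
`Σ_{x ≠ y} a(⟨x,y⟩) ≥ N² α_0 - N h(1)` (`CircleLP.energy_ge`), and the all-`k` Newton-form certificate
theorem `NewtonCert.energy_ge_circle` (as `NewtonCert.energy_ge`, Chebyshev basis) follows; it is used
for the regular polygons (Cohn–Kumar 2007, Table 1, first row) in `UniversalOptimalityPolygon*.lean`.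

## References
* H. Cohn, A. Kumar, *Universally optimal distribution of points on spheres*, J. Amer. Math. Soc.
  20 (2007) 99–148, Prop. 4.1, Table 1. [`CohnKumar2006`]
-/

noncomputable section

namespace Summit.Ventures.PackingBounds.Energy

open Finset Polynomial.Chebyshev

namespace CircleLP

/-- An explicit angle for a point of the plane: `arccos` of the first coordinate, with the sign of the
second. [folklore] -/
private theorem cos_sin_angle (x : EuclideanSpace ℝ (Fin 2)) (hx : ‖x‖ = 1) :
    Real.cos (if 0 ≤ x 1 then Real.arccos (x 0) else -Real.arccos (x 0)) = x 0 ∧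
    Real.sin (if 0 ≤ x 1 then Real.arccos (x 0) else -Real.arccos (x 0)) = x 1 := by
  have hsq : x 0 ^ 2 + x 1 ^ 2 = 1 := by
    have h := EuclideanSpace.real_norm_sq_eq x
    rw [hx, one_pow, Fin.sum_univ_two] at h
    linarith
  have h0 : -1 ≤ x 0 := by nlinarith [sq_nonneg (x 1), sq_nonneg (x 0 + 1)]
  have h0' : x 0 ≤ 1 := by nlinarith [sq_nonneg (x 1), sq_nonneg (x 0 - 1)]
  have hs : Real.sqrt (1 - x 0 ^ 2) = |x 1| := by
    rw [show 1 - x 0 ^ 2 = x 1 ^ 2 by linarith, Real.sqrt_sq_eq_abs]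
  split_ifs with h
  · exact ⟨Real.cos_arccos h0 h0', by rw [Real.sin_arccos, hs, abs_of_nonneg h]⟩
  · refine ⟨by rw [Real.cos_neg, Real.cos_arccos h0 h0'], ?_⟩
    rw [Real.sin_neg, Real.sin_arccos, hs, abs_of_neg (lt_of_not_ge h), neg_neg]

/-- **Positive definiteness of the Chebyshev kernels on the circle**: for unit vectors of `ℝ²`,
`Σ_{x,y ∈ C} T_k(⟨x,y⟩) = (Σ_x cos kθ_x)² + (Σ_x sin kθ_x)² ≥ 0`. [folklore] -/
theorem sum_sum_chebyshev_nonneg (C : Finset (EuclideanSpace ℝ (Fin 2))) (h1 : ∀ x ∈ C, ‖x‖ = 1)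
    (k : ℕ) : 0 ≤ ∑ x ∈ C, ∑ y ∈ C, (T ℝ k).eval (inner ℝ x y) := by
  set θ : EuclideanSpace ℝ (Fin 2) → ℝ := fun x =>
    if 0 ≤ x 1 then Real.arccos (x 0) else -Real.arccos (x 0) with hθ
  have hcs : ∀ x ∈ C, Real.cos (θ x) = x 0 ∧ Real.sin (θ x) = x 1 := fun x hx =>
    cos_sin_angle x (h1 x hx)
  have hinner : ∀ x ∈ C, ∀ y ∈ C, inner ℝ x y = Real.cos (θ x - θ y) := by
    intro x hx y hy
    rw [Real.cos_sub, (hcs x hx).1, (hcs x hx).2, (hcs y hy).1, (hcs y hy).2]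
    simp [PiLp.inner_apply, Fin.sum_univ_two, mul_comm]
  have hT : ∀ x ∈ C, ∀ y ∈ C, (T ℝ k).eval (inner ℝ x y) =
      Real.cos (k * θ x) * Real.cos (k * θ y) + Real.sin (k * θ x) * Real.sin (k * θ y) := by
    intro x hx y hy
    rw [hinner x hx y hy, T_real_cos, ← Real.cos_sub]
    push_cast
    ring_nf
  calc (0 : ℝ) ≤ (∑ x ∈ C, Real.cos (k * θ x)) ^ 2 + (∑ x ∈ C, Real.sin (k * θ x)) ^ 2 := by
        positivity
    _ = ∑ x ∈ C, ∑ y ∈ C, (Real.cos (k * θ x) * Real.cos (k * θ y) +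
          Real.sin (k * θ x) * Real.sin (k * θ y)) := by
        rw [sq, sq, Finset.sum_mul_sum, Finset.sum_mul_sum, ← Finset.sum_add_distrib]
        exact Finset.sum_congr rfl fun x _ => by rw [← Finset.sum_add_distrib]
    _ = ∑ x ∈ C, ∑ y ∈ C, (T ℝ k).eval (inner ℝ x y) :=
        Finset.sum_congr rfl fun x hx => Finset.sum_congr rfl fun y hy => (hT x hx y hy).symm

open scoped Classical in
/-- **The linear programming bound for energy on `S¹`** (Yudin / Cohn–Kumar Prop. 4.1 with Chebyshev
kernels): if `α_k ≥ 0` and `Σ_{k ≤ d} α_k T_k(t) ≤ a(t)` for `-1 ≤ t < 1`, every finite set `C` of unit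
vectors of `ℝ²` has `|C|² α_0 - |C| Σ_k α_k T_k(1) ≤ Σ_{x ≠ y ∈ C} a(⟨x,y⟩)`.
[cite: CohnKumar2006, Proposition 4.1] -/
theorem energy_ge (d : ℕ) (α : ℕ → ℝ) (hα : ∀ k, 0 ≤ α k) (a : ℝ → ℝ)
    (hH : ∀ t : ℝ, -1 ≤ t → t < 1 → ∑ k ∈ range (d + 1), α k * (T ℝ k).eval t ≤ a t)
    (C : Finset (EuclideanSpace ℝ (Fin 2))) (h1 : ∀ x ∈ C, ‖x‖ = 1) :
    (C.card : ℝ) ^ 2 * α 0 - (C.card : ℝ) * ∑ k ∈ range (d + 1), α k * (T ℝ k).eval 1 ≤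
      ∑ x ∈ C, ∑ y ∈ C.erase x, a (inner ℝ x y) := by
  set h : ℝ → ℝ := fun t => ∑ k ∈ range (d + 1), α k * (T ℝ k).eval t with hdef
  -- lower bound: S ≥ |C|² α₀
  have hlow : (C.card : ℝ) ^ 2 * α 0 ≤ ∑ x ∈ C, ∑ y ∈ C, h (inner ℝ x y) := by
    have hswap : ∑ x ∈ C, ∑ y ∈ C, h (inner ℝ x y) =
        ∑ k ∈ range (d + 1), α k * ∑ x ∈ C, ∑ y ∈ C, (T ℝ k).eval (inner ℝ x y) := by
      have h1' : ∀ x, ∑ y ∈ C, h (inner ℝ x y) =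
          ∑ k ∈ range (d + 1), ∑ y ∈ C, α k * (T ℝ k).eval (inner ℝ x y) := fun x => by
        simp only [hdef]; exact Finset.sum_comm
      rw [Finset.sum_congr rfl fun x _ => h1' x, Finset.sum_comm]
      refine Finset.sum_congr rfl fun k _ => ?_
      rw [Finset.mul_sum]
      exact Finset.sum_congr rfl fun x _ => by rw [Finset.mul_sum]
    rw [hswap]
    have h0 : α 0 * ∑ x ∈ C, ∑ y ∈ C, (T ℝ (0 : ℕ)).eval (inner ℝ x y) = (C.card : ℝ) ^ 2 * α 0 := by
      simp [T_zero]; ring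
    rw [← h0]
    exact Finset.single_le_sum (fun k _ => mul_nonneg (hα k) (sum_sum_chebyshev_nonneg C h1 k))
      (Finset.mem_range.2 (Nat.succ_pos d))
  -- upper bound: S ≤ |C| h(1) + E
  have hupp : ∑ x ∈ C, ∑ y ∈ C, h (inner ℝ x y) ≤
      (C.card : ℝ) * h 1 + ∑ x ∈ C, ∑ y ∈ C.erase x, a (inner ℝ x y) := by
    have hrow : ∀ x ∈ C, ∑ y ∈ C, h (inner ℝ x y) ≤ h 1 + ∑ y ∈ C.erase x, a (inner ℝ x y) := by
      intro x hx
      rw [← Finset.add_sum_erase _ _ hx]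
      have hxx : inner ℝ x x = 1 := by
        rw [real_inner_self_eq_norm_sq, h1 x hx, one_pow]
      rw [hxx]
      have hoff : ∑ y ∈ C.erase x, h (inner ℝ x y) ≤ ∑ y ∈ C.erase x, a (inner ℝ x y) :=
        Finset.sum_le_sum fun y hy => by
          have hb := NewtonCert.inner_mem_Ico_of_norm_eq_one (h1 x hx)
            (h1 y (Finset.mem_of_mem_erase hy)) (Finset.ne_of_mem_erase hy).symm
          exact hH _ hb.1 hb.2
      linarith
    calc ∑ x ∈ C, ∑ y ∈ C, h (inner ℝ x y) ≤ ∑ x ∈ C, (h 1 + ∑ y ∈ C.erase x, a (inner ℝ x y)) :=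
          Finset.sum_le_sum hrow
      _ = (C.card : ℝ) * h 1 + ∑ x ∈ C, ∑ y ∈ C.erase x, a (inner ℝ x y) := by
        rw [Finset.sum_add_distrib, Finset.sum_const, nsmul_eq_mul]
  have := hlow.trans hupp
  simp only [hdef] at this
  linarith

end CircleLP

namespace NewtonCert

open scoped Classical in
/-- **All-`k` Newton-form certificate on the circle** (Chebyshev basis): as `NewtonCert.energy_ge`
with `C_i^{μ}` replaced by `T_i` and the LP bound `CircleLP.energy_ge`. For node values `v_i ≥ 0`
(`u = 1 + t`), a table `G ≥ 0` with `ω_j(1+t) = Σ_i G_{j,i} T_i(t)` and the design identities, every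
`N`-point configuration `C ⊂ S¹` has `Σ_{x ≠ y} (1 + ⟨x,y⟩)^k ≥ N Σ_i m_i v_i^k` for every `k`.
[cite: CohnKumar2006, Theorem 1.2 and Proposition 4.1] -/
theorem energy_ge_circle (D : ℕ) (hD : 1 ≤ D) (v : ℕ → ℝ) (hv : ∀ i, 0 ≤ v i)
    (hωD : ∀ u : ℝ, 0 ≤ u → 0 ≤ ∏ i ∈ range D, (u - v i))
    (G : ℕ → ℕ → ℝ) (hG : ∀ j i, 0 ≤ G j i)
    (hGid : ∀ j < D, ∀ t : ℝ,
      ∏ i ∈ range j, (1 + t - v i) = ∑ i ∈ range D, G j i * (T ℝ i).eval t)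
    (N M : ℕ) (hM : M ≤ D) (mult : ℕ → ℝ)
    (hdesign : ∀ j < D, (N : ℝ) * G j 0 =
      ∏ i ∈ range j, (2 - v i) + ∑ i ∈ range M, mult i * ∏ i' ∈ range j, (v i - v i'))
    (k : ℕ) (C : Finset (EuclideanSpace ℝ (Fin 2))) (h1 : ∀ x ∈ C, ‖x‖ = 1) (hN : C.card = N) :
    (N : ℝ) * ∑ i ∈ range M, mult i * v i ^ k ≤
      ∑ x ∈ C, ∑ y ∈ C.erase x, (1 + inner ℝ x y) ^ k := by
  obtain ⟨c, r, hc, hr, hexp⟩ := newton_exists v hv D hD k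
  set α : ℕ → ℝ := fun i => ∑ j ∈ range D, c j * G j i with hαdef
  have hα : ∀ i, 0 ≤ α i := fun i =>
    Finset.sum_nonneg fun j _ => mul_nonneg (hc j) (hG j i)
  have hswap : ∀ t : ℝ, ∑ i ∈ range D, α i * (T ℝ i).eval t =
      ∑ j ∈ range D, c j * ∏ i ∈ range j, (1 + t - v i) := by
    intro t
    calc ∑ i ∈ range D, α i * (T ℝ i).eval t
          = ∑ i ∈ range D, ∑ j ∈ range D, c j * G j i * (T ℝ i).eval t := by
            refine Finset.sum_congr rfl fun i _ => ?_
            rw [hαdef, Finset.sum_mul]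
      _ = ∑ j ∈ range D, ∑ i ∈ range D, c j * G j i * (T ℝ i).eval t := Finset.sum_comm
      _ = ∑ j ∈ range D, c j * ∏ i ∈ range j, (1 + t - v i) := by
            refine Finset.sum_congr rfl fun j hj => ?_
            rw [hGid j (Finset.mem_range.1 hj) t, Finset.mul_sum]
            exact Finset.sum_congr rfl fun i _ => by ring
  have hD' : D - 1 + 1 = D := Nat.sub_add_cancel hD
  have hH : ∀ t : ℝ, -1 ≤ t → t < 1 →
      ∑ i ∈ range (D - 1 + 1), α i * (T ℝ i).eval t ≤ (fun t : ℝ => (1 + t) ^ k) t := by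
    intro t ht _
    rw [hD', hswap t]
    have hu : (0 : ℝ) ≤ 1 + t := by linarith
    dsimp only
    rw [hexp (1 + t)]
    exact le_add_of_nonneg_right (mul_nonneg (hr _ hu) (hωD _ hu))
  have key := CircleLP.energy_ge (D - 1) α hα (fun t : ℝ => (1 + t) ^ k) hH C h1
  have h2 : ∑ j ∈ range D, c j * ∏ i ∈ range j, (1 + 1 - v i) =
      ∑ j ∈ range D, c j * ∏ i ∈ range j, ((2 : ℝ) - v i) :=
    Finset.sum_congr rfl fun j _ => by
      rw [Finset.prod_congr rfl fun i _ => by rw [show (1 : ℝ) + 1 = 2 by norm_num]]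
  have hα0 : α 0 = ∑ j ∈ range D, c j * G j 0 := by rw [hαdef]
  rw [hD', hN, hswap 1, h2, hα0] at key
  refine le_trans (le_of_eq ?_) key
  have hval : ∀ j ∈ range D, (N : ℝ) * G j 0 - ∏ i ∈ range j, (2 - v i) =
      ∑ i ∈ range M, mult i * ∏ i' ∈ range j, (v i - v i') := fun j hj => by
    rw [hdesign j (Finset.mem_range.1 hj)]; ring
  have hnode : ∀ i ∈ range M, ∑ j ∈ range D, c j * ∏ i' ∈ range j, (v i - v i') = v i ^ k := by
    intro i hi
    have h := hexp (v i)
    rw [omega_node v (lt_of_lt_of_le (Finset.mem_range.1 hi) hM), mul_zero, add_zero] at h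
    exact h.symm
  calc (N : ℝ) * ∑ i ∈ range M, mult i * v i ^ k
        = (N : ℝ) * ∑ i ∈ range M, mult i *
            ∑ j ∈ range D, c j * ∏ i' ∈ range j, (v i - v i') := by
          congr 1; exact Finset.sum_congr rfl fun i hi => by rw [hnode i hi]
    _ = (N : ℝ) * ∑ j ∈ range D, c j *
            ∑ i ∈ range M, mult i * ∏ i' ∈ range j, (v i - v i') := by
          congr 1
          rw [Finset.sum_congr rfl fun i _ => Finset.mul_sum (range D) _ (mult i), Finset.sum_comm]
          refine Finset.sum_congr rfl fun j _ => ?_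
          rw [Finset.mul_sum]
          exact Finset.sum_congr rfl fun i _ => by ring
    _ = (N : ℝ) * ∑ j ∈ range D, c j * ((N : ℝ) * G j 0 - ∏ i ∈ range j, (2 - v i)) := by
          congr 1; exact Finset.sum_congr rfl fun j hj => by rw [hval j hj]
    _ = (N : ℝ) ^ 2 * ∑ j ∈ range D, c j * G j 0 -
          (N : ℝ) * ∑ j ∈ range D, c j * ∏ i ∈ range j, (2 - v i) := by
          rw [Finset.mul_sum, Finset.mul_sum, Finset.mul_sum, ← Finset.sum_sub_distrib]
          exact Finset.sum_congr rfl fun j _ => by ring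

end NewtonCert

end Summit.Ventures.PackingBounds.Energy

end
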